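import Literature.AlgebraicGeometry.AbelianSchemes.AbelianSchemeBaseChangeComp
import Literature.AlgebraicGeometry.AbelianSchemes.AbelianSchemeOverFibreIdentity
import Literature.AlgebraicGeometry.AbelianVarieties.StructureSheafSemiHomogeneous
import Literature.AlgebraicGeometry.Motives.AbelianVarietyRigidity
import HarnessLib

/-!
# The dual transport `Ĥ_e : Â' ≅ Â` of an isomorphism of abelian schemes, its Poincaré clause, and (over a field)
# its homomorphism property — clauses (ii)+(iii) of [MFK94] Def. 7.3 along `𝟙 S` from the universal property of the dual

Topic `AlgebraicGeometry/AbelianSchemes`; namespace `Literature.AlgebraicGeometry.AbelianSchemes.AbelianSchemeOver(.DualPair)`.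
Cell hodgecm-mathlib (D-0151), rung-0 ladder / M1PRIME-DAG **W3c (c-ii-H)** («triple transport», census B-p13; B-p11's
`TripleTransportAlongId` clauses (ii)+(iii)) over ★ D1 `AbelianSchemeOverBase`, ★ D2 `AbelianSchemeDualPair`, ★
`AbelianSchemeBaseChangeComp` (B-p02: `fibreBaseChangeIso`, `unitSection_baseChange_comp_fst`,
`isHomogeneous_pullback_iff_of_iso`), ★ `AbelianSchemeOverFibreIdentity` (`isBaseChangeVia_id_of_isMonHom`), ★
`Motives/AbelianVarietyRigidity` (`isMonHom_of_one_comp`, [MilneAV] I Cor. 1.2) and ★ `StructureSheafSemiHomogeneous`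
(`hasRank_unit_one`, `isHomogeneous_unit`).  DEFINITIONS WITH BODIES (non-Prop plumbing: `fibreIsoOfIso`, `transportMap`,
`transportBundle`, `hatTransport`, `transportMapInv`, `selfBundle`, `hatTransportIso`, `unitHatSlice`, `trivialBundle`,
`hatTransportOver`; no `Prop`-valued def) + THEOREMS; no structure, no named fact, no instance, no `sorry`; books 0.
HC_CM is proved only modulo the printed citations until rung 0 closes.

## What is here ([MilneAV2008] I §8 «there is a unique regular map `α : T → A^∨` such that `(1 × α)^*𝒫 ≈ ℒ`», applied
## with `T = Â'` to the transported Poincaré family)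
* §0 for an isomorphism of `S`-group schemes `e : A'.X ≅ A.X` (`[IsMonHom e.hom]`): unit compatibilities and the induced
  isomorphisms of the fibres `fibreIsoOfIso e s : A'_s ≅ A_s` (abelian varieties; `Over.pullback s` on group objects);
* §1 the transported family `transportBundle D' e = (e⁻¹ × 1)^*𝒫'` on `A ×_S Â'` as a `RigidifiedLineBundle` over `Â'`,
  rigidified (`ε ≫ (e⁻¹ × 1) = ε_{A'} × 1`) and fibrewise in `Pic⁰` (`transportBundle_fibrewisePicZero`: the fibre at `t`
  is the `𝒫'`-slice transported along `(A_{Â'})_t ≅ A_{t ≫ π̂'} ≅ A'_{t ≫ π̂'}`);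
* §2 **`hatTransport D D' e : Â' → Â`** = D2 `classify` of that family, over `S` (`hatTransport_comp_hom`), with
  `(1 × Ĥ_e)^*𝒫 ≅ (e⁻¹ × 1)^*𝒫'` and hence **the Poincaré clause `(e × Ĥ_e)^*𝒫 ≅ 𝒫'`**
  (`nonempty_pullback_map_hatTransport_iso`, the shape of clause (iii) of ★ D4 `PolarizedAbelianSchemeWithLevel.IsBaseChangeVia`
  along `𝟙 S`);
* §3 **`Ĥ_e` is an isomorphism** (`hatTransport_comp_hatTransport`: `Ĥ_{e⁻¹} ≫ Ĥ_e = 𝟙` by uniqueness — both classify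
  `𝒫` itself, `selfBundle`; `hatTransportIso`, `isIso_hatTransport`; the inverse iso `e'` is passed with `e'.hom = e.inv`
  because `IsMonHom e.symm.hom` is not found by instance search);
* §4 **units**: the hypothesis «`𝒫|_{A × {ε_Â}} ≅ 𝒪`» (`Nonempty ((pullback (unitHatSlice D)).obj 𝒫 ≅ 𝒪)`; NOT a field of D2 —
  it holds for polarised abelian schemes: `λ(1) = ε_Â` and `IsLambdaOfAt` at the origin) ⟹ `unitSection_comp_hatTransport : ε_{Â'} ≫ Ĥ_e = ε_Â` (both classify
  the trivial family `trivialBundle`); over a FIELD, rigidity ⟹ `isMonHom_hatTransportOver` ⟹ **clause (ii)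
  `hat_isBaseChangeVia_id_hatTransport : D'.hat.IsBaseChangeVia D.hat (𝟙 (Spec K)) (hatTransport D D' e)`**.

## What is NOT here (recorded)
* `nonempty_unitHatSlice_iso_of_isLambdaOfAt` (the §4 hypothesis from a polarisation `λ` with `IsLambdaOfAt (𝟙 _) D λ Θ`: the slice at
  `λ(1) = 1_Â` is `t_1^*𝒪(Θ) ⊗ 𝒪(Θ)^∨ ≅ 𝒪` — the P36 determinant-class calculus) — next leaf;
* the `IsLambdaOfAt` transport along `(e, Ĥ_e)` ((c-ii-T)) and the λ-clause (iv) ((c-iii), B-p03).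

## References
* [MilneAV2008] J. S. Milne, *Abelian Varieties* (v2.00, 2008), I §8 pp. 36–37 (the dual: definition by the universal
  property, uniqueness of the classifying map), I Cor. 1.2 p. 8 (rigidity: a morphism preserving the origin is a homomorphism).
* [MumfordFogartyKirwan1994] D. Mumford, J. Fogarty, F. Kirwan, *Geometric Invariant Theory*, 3rd ed. (1994), Ch. 6 §1
  Cor. 6.4 (p. 117) (rigidity over a base), §2 (p. 121) and Def. 6.2 (p. 120) (normalised Poincaré sheaf, `Λ(L)`), Ch. 7 §2
  Definition 7.3 (p. 130) (pull-back / isomorphism of triples).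
* [MumfordAV1970] D. Mumford, *Abelian Varieties* (1970), §8 ((iv) ⇔ (i)) (`Pic⁰` = translation-invariant line bundles).
* [GortzWedhorn2020] U. Görtz, T. Wedhorn, *Algebraic Geometry I*, 2nd ed. (2020), Section (4.7) (p. 135), Remark 16.54
  (p. 678) (base change, fibres of group schemes).
-/

set_option autoImplicit false

universe u

open CategoryTheory CategoryTheory.Limits AlgebraicGeometry MonoidalCategory

noncomputable section

namespace Literature.AlgebraicGeometry.AbelianSchemes

namespace AbelianSchemeOver

open Literature.AlgebraicGeometry.Motives Literature.AlgebraicGeometry.Modules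
open Literature.AlgebraicGeometry.AbelianVarieties
open scoped MonObj

variable {S : Scheme.{u}} {A A' : AbelianSchemeOver S}

/-! ### §0 An isomorphism of `S`-group schemes: unit compatibilities and the induced isomorphisms of the fibres -/

section IsoOfGroupSchemes

variable (e : A'.X ≅ A.X) [IsMonHom e.hom]

/-- `ε_A ≫ e⁻¹ = ε_{A'}` on underlying schemes. [cite: MumfordFogartyKirwan1994, Ch. 6 §1 Definition 6.1 (p. 115)] -/
theorem unitSection_comp_inv_left : A.unitSection ≫ e.inv.left = A'.unitSection := by
  change (η[A.X]).left ≫ e.inv.left = (η[A'.X]).left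
  rw [← Over.comp_left, IsMonHom.one_hom]

/-- `ε_{A'} ≫ e = ε_A` on underlying schemes. [cite: MumfordFogartyKirwan1994, Ch. 6 §1 Definition 6.1 (p. 115)] -/
theorem unitSection_comp_hom_left : A'.unitSection ≫ e.hom.left = A.unitSection := by
  change (η[A'.X]).left ≫ e.hom.left = (η[A.X]).left
  rw [← Over.comp_left, IsMonHom.one_hom]

variable {Ω : Type u} [Field Ω] (s : Spec (.of Ω) ⟶ S)

/-- **The isomorphism of the fibres `A'_s ≅ A_s` (as abelian varieties over `Ω`) induced by an isomorphism of
`S`-group schemes `e : A' ≅ A`** — the cartesian-monoidal base-change functor `Over.pullback s` on group objects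
(`Functor.mapGrp`, `Grp.mkIso'`), through `InducedCategory.isoMk`. [cite: GortzWedhorn2020, Section (4.7) (p. 135) and Remark 16.54 (p. 678)] -/
def fibreIsoOfIso : (A'.fibre s).toAbelianVariety ≅ (A.fibre s).toAbelianVariety :=
  InducedCategory.isoMk (X := (A'.fibre s).toAbelianVariety) (Y := (A.fibre s).toAbelianVariety)
    ((Over.pullback s).mapGrp.mapIso (Grp.mkIso' e))

/-- Its underlying morphism of schemes is `(Over.pullback s).map e.hom` read on `left` (definitional).
[cite: GortzWedhorn2020, Section (4.7) (p. 135)] -/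
theorem fibreIsoOfIso_hom_toSchemeHom :
    AbelianVariety.Hom.toSchemeHom (fibreIsoOfIso e s).hom = ((Over.pullback s).map e.hom).left := rfl

/-- `fibreIsoOfIso` over the first projections: `A'_s → A_s → A` is `A'_s → A' → A`. [cite: GortzWedhorn2020, Section (4.7) (p. 135)] -/
theorem fibreIsoOfIso_hom_toSchemeHom_fst :
    AbelianVariety.Hom.toSchemeHom (fibreIsoOfIso e s).hom ≫ pullback.fst A.X.hom s =
      pullback.fst A'.X.hom s ≫ e.hom.left :=
  (congrArg (fun x => x ≫ pullback.fst A.X.hom s) (Over.pullback_map_left s A'.X (k := e.hom))).trans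
    (pullback.lift_fst _ _ _)

/-- `fibreIsoOfIso` lies over `Spec Ω`. [cite: GortzWedhorn2020, Section (4.7) (p. 135)] -/
theorem fibreIsoOfIso_hom_toSchemeHom_snd :
    AbelianVariety.Hom.toSchemeHom (fibreIsoOfIso e s).hom ≫ pullback.snd A.X.hom s = pullback.snd A'.X.hom s :=
  (congrArg (fun x => x ≫ pullback.snd A.X.hom s) (Over.pullback_map_left s A'.X (k := e.hom))).trans
    (pullback.lift_snd _ _ _)

end IsoOfGroupSchemes

namespace DualPair

variable (D : A.DualPair) (D' : A'.DualPair) (e : A'.X ≅ A.X) [IsMonHom e.hom]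

/-! ### §1 The transported family `(e⁻¹ × 1)^*𝒫'` on `A ×_S Â'` -/

/-- `e⁻¹ × 1_{Â'} : A ×_S Â' → A' ×_S Â'` (non-Prop plumbing). [cite: MilneAV2008, I §8 pp. 36–37] -/
def transportMap : (A.baseChange D'.hat.X.hom).left ⟶ A'.prodLeft D'.hat :=
  pullback.map A.X.hom D'.hat.X.hom A'.X.hom D'.hat.X.hom e.inv.left (𝟙 _) (𝟙 S)
    (by rw [Category.comp_id, Over.w e.inv]) (by rw [Category.comp_id, Category.id_comp])

omit [IsMonHom e.hom] in
/-- First projection of `e⁻¹ × 1`. [cite: MilneAV2008, I §8 pp. 36–37] -/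
@[reassoc (attr := simp)]
theorem transportMap_fst : transportMap D' e ≫ pullback.fst A'.X.hom D'.hat.X.hom =
    pullback.fst A.X.hom D'.hat.X.hom ≫ e.inv.left :=
  pullback.lift_fst _ _ _

omit [IsMonHom e.hom] in
/-- Second projection of `e⁻¹ × 1`. [cite: MilneAV2008, I §8 pp. 36–37] -/
@[reassoc (attr := simp)]
theorem transportMap_snd : transportMap D' e ≫ pullback.snd A'.X.hom D'.hat.X.hom =
    pullback.snd A.X.hom D'.hat.X.hom :=
  (pullback.lift_snd _ _ _).trans (Category.comp_id _)

/-- The unit section of `A_{Â'}` followed by `e⁻¹ × 1` is the unit slice `ε_{A'} × 1` of `A' ×_S Â'`.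
[cite: MilneAV2008, I §8 pp. 36–37] -/
theorem unitSection_baseChange_comp_transportMap :
    (A.baseChange D'.hat.X.hom).unitSection ≫ transportMap D' e = A'.unitSlice D'.hat := by
  have hsec : (A.baseChange D'.hat.X.hom).unitSection ≫ pullback.snd A.X.hom D'.hat.X.hom = 𝟙 _ :=
    (A.baseChange D'.hat.X.hom).unitSection_comp_hom
  apply pullback.hom_ext
  · exact (Category.assoc _ _ _).trans
      ((congrArg (fun x => (A.baseChange D'.hat.X.hom).unitSection ≫ x) (transportMap_fst D' e)).trans
        ((Category.assoc _ _ _).symm.trans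
          ((congrArg (fun x => x ≫ e.inv.left) (unitSection_baseChange_comp_fst A D'.hat.X.hom)).trans
            ((Category.assoc _ _ _).trans
              ((congrArg (fun x => D'.hat.X.hom ≫ x) (unitSection_comp_inv_left e)).trans
                (A'.unitSlice_fst D'.hat).symm)))))
  · exact (Category.assoc _ _ _).trans
      ((congrArg (fun x => (A.baseChange D'.hat.X.hom).unitSection ≫ x) (transportMap_snd D' e)).trans
        (hsec.trans (A'.unitSlice_snd D'.hat).symm))

/-- **The transported family**: `(e⁻¹ × 1)^*𝒫'` as a rigidified line bundle on `A_{Â'} = A ×_S Â'` (rigidified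
because `ε_{A_{Â'}} ≫ (e⁻¹ × 1) = ε_{A'} × 1` and `𝒫'` is normalised there). [cite: MilneAV2008, I §8 pp. 36–37]
[cite: MumfordFogartyKirwan1994, Ch. 6 §2 (p. 121)] -/
def transportBundle : A.RigidifiedLineBundle D'.hat.X.hom where
  L := (Scheme.Modules.pullback (transportMap D' e)).obj D'.P
  hasRank_one := hasRank_pullback _ D'.hasRank_one
  rigid := ⟨(Scheme.Modules.pullbackComp _ _).app D'.P ≪≫
    (Scheme.Modules.pullbackCongr (unitSection_baseChange_comp_transportMap D' e)).app D'.P ≪≫ D'.rigid.some⟩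

/-- The module of the transported family. [cite: MilneAV2008, I §8 pp. 36–37] -/
@[simp] theorem transportBundle_L :
    (transportBundle D' e).L = (Scheme.Modules.pullback (transportMap D' e)).obj D'.P := rfl

set_option maxHeartbeats 400000 in
/-- **The transported family lies fibrewise in `Pic⁰`**: at a geometric point `t` of `Â'` its fibre is the
`𝒫'`-slice `𝒫'|_{A'_{t ≫ π̂'} × {t}}` transported along `(A_{Â'})_t ≅ A_{t ≫ π̂'} ≅ A'_{t ≫ π̂'}` (B-p02's `fibreBaseChangeIso`,
`fibreIsoOfIso e`), and translation invariance is invariant under isomorphisms of abelian varieties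
(`isHomogeneous_pullback_iff_of_iso`). [cite: MumfordAV1970, §8 ((iv) ⇔ (i))] [cite: MilneAV2008, I §8 pp. 36–37] -/
theorem transportBundle_fibrewisePicZero : (transportBundle D' e).FibrewisePicZero := by
  intro Ω _ _ t
  -- the comparison iso `(A_{Â'})_t ≅ A'_{t ≫ π̂'}` and its square over the slices
  let φ : ((A.baseChange D'.hat.X.hom).fibre t).toAbelianVariety ≅ (A'.fibre (t ≫ D'.hat.X.hom)).toAbelianVariety :=
    A.fibreBaseChangeIso D'.hat.X.hom t ≪≫ (fibreIsoOfIso e (t ≫ D'.hat.X.hom)).symm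
  have key := D'.fibrewisePicZero Ω t
  have hφ : AbelianVariety.Hom.toSchemeHom φ.hom ≫ AbelianVariety.Hom.toSchemeHom (fibreIsoOfIso e (t ≫ D'.hat.X.hom)).hom =
      AbelianVariety.Hom.toSchemeHom (A.fibreBaseChangeIso D'.hat.X.hom t).hom := by
    change AbelianVariety.Hom.toSchemeHom ((A.fibreBaseChangeIso D'.hat.X.hom t).hom ≫
        (fibreIsoOfIso e (t ≫ D'.hat.X.hom)).inv) ≫ _ = _
    change AbelianVariety.Hom.toSchemeHom (((A.fibreBaseChangeIso D'.hat.X.hom t).hom ≫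
        (fibreIsoOfIso e (t ≫ D'.hat.X.hom)).inv) ≫ (fibreIsoOfIso e (t ≫ D'.hat.X.hom)).hom) = _
    rw [Category.assoc, Iso.inv_hom_id, Category.comp_id]
  have hcond : pullback.fst (A.baseChange D'.hat.X.hom).X.hom t ≫ pullback.snd A.X.hom D'.hat.X.hom =
      pullback.snd (A.baseChange D'.hat.X.hom).X.hom t ≫ t := pullback.condition
  -- fst components through `A`: `φ ≫ fst' ≫ e.hom = fst_t ≫ fst`
  have h1 : (AbelianVariety.Hom.toSchemeHom φ.hom ≫ pullback.fst A'.X.hom (t ≫ D'.hat.X.hom)) ≫ e.hom.left =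
      pullback.fst (pullback.snd A.X.hom D'.hat.X.hom) t ≫ pullback.fst A.X.hom D'.hat.X.hom :=
    (Category.assoc _ _ _).trans
      ((congrArg (fun x => AbelianVariety.Hom.toSchemeHom φ.hom ≫ x)
          (fibreIsoOfIso_hom_toSchemeHom_fst e (t ≫ D'.hat.X.hom)).symm).trans
        ((Category.assoc _ _ _).symm.trans
          ((congrArg (fun x => x ≫ pullback.fst A.X.hom (t ≫ D'.hat.X.hom)) hφ).trans
            (A.fibreBaseChangeIso_hom_toSchemeHom_fst D'.hat.X.hom t))))
  have hee : e.hom.left ≫ e.inv.left = 𝟙 _ := by rw [← Over.comp_left, Iso.hom_inv_id, Over.id_left]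
  have h1' : AbelianVariety.Hom.toSchemeHom φ.hom ≫ pullback.fst A'.X.hom (t ≫ D'.hat.X.hom) =
      (pullback.fst (pullback.snd A.X.hom D'.hat.X.hom) t ≫ pullback.fst A.X.hom D'.hat.X.hom) ≫ e.inv.left :=
    ((Category.assoc _ _ _).trans
      ((congrArg (fun x => (AbelianVariety.Hom.toSchemeHom φ.hom ≫ pullback.fst A'.X.hom (t ≫ D'.hat.X.hom)) ≫ x)
        hee).trans (Category.comp_id _))).symm.trans (congrArg (fun x => x ≫ e.inv.left) h1)
  have h2 : AbelianVariety.Hom.toSchemeHom φ.hom ≫ pullback.snd A'.X.hom (t ≫ D'.hat.X.hom) =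
      pullback.snd (pullback.snd A.X.hom D'.hat.X.hom) t :=
    (congrArg (fun x => AbelianVariety.Hom.toSchemeHom φ.hom ≫ x)
        (fibreIsoOfIso_hom_toSchemeHom_snd e (t ≫ D'.hat.X.hom)).symm).trans
      ((Category.assoc _ _ _).symm.trans
        ((congrArg (fun x => x ≫ pullback.snd A.X.hom (t ≫ D'.hat.X.hom)) hφ).trans
          (A.fibreBaseChangeIso_hom_toSchemeHom_snd D'.hat.X.hom t)))
  have hc : AbelianVariety.Hom.toSchemeHom φ.hom ≫ A'.fibreSlice D'.hat t =
      pullback.fst (A.baseChange D'.hat.X.hom).X.hom t ≫ transportMap D' e := by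
    apply pullback.hom_ext
    · exact (Category.assoc _ _ _).trans
        ((congrArg (fun x => AbelianVariety.Hom.toSchemeHom φ.hom ≫ x) (A'.fibreSlice_fst D'.hat t)).trans
          (h1'.trans
            ((Category.assoc _ _ _).trans
              ((congrArg (fun x => pullback.fst (A.baseChange D'.hat.X.hom).X.hom t ≫ x)
                  (transportMap_fst D' e).symm).trans
                (Category.assoc _ _ _).symm))))
    · exact (Category.assoc _ _ _).trans
        ((congrArg (fun x => AbelianVariety.Hom.toSchemeHom φ.hom ≫ x) (A'.fibreSlice_snd D'.hat t)).trans
          ((Category.assoc _ _ _).symm.trans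
            ((congrArg (fun x => x ≫ t) h2).trans
              (hcond.symm.trans
                ((congrArg (fun x => pullback.fst (A.baseChange D'.hat.X.hom).X.hom t ≫ x)
                    (transportMap_snd D' e).symm).trans
                  (Category.assoc _ _ _).symm)))))
  have k1 := (isHomogeneous_pullback_iff_of_iso φ _).2 key
  exact (isHomogeneous_iff_of_iso _ ((Scheme.Modules.pullbackComp _ _).app D'.P ≪≫
    (Scheme.Modules.pullbackCongr hc).app D'.P ≪≫ ((Scheme.Modules.pullbackComp _ _).app D'.P).symm)).1 k1

/-! ### §2 The dual transport `Ĥ : Â' → Â` and its Poincaré clause -/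

/-- **The dual transport** `Ĥ_e : Â' → Â` over `S` of an isomorphism of `S`-group schemes `e : A' ≅ A` between abelian
schemes carrying dual pairs `(Â', 𝒫')`, `(Â, 𝒫)`: the classifying morphism (D2 `universal`) of the transported family
`(e⁻¹ × 1)^*𝒫'` on `A ×_S Â'` — [MilneAV2008, I §8] «a unique regular map `α : T → A^∨` such that `(1 × α)^*𝒫 ≈ ℒ`»
with `T = Â'`. [cite: MilneAV2008, I §8 pp. 36–37] [cite: MumfordFogartyKirwan1994, Ch. 7 §2 Definition 7.3 (p. 130)] -/
def hatTransport : D'.hat.X.left ⟶ D.hat.X.left :=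
  D.classify D'.hat.X.hom (transportBundle D' e) (transportBundle_fibrewisePicZero D' e)

/-- `Ĥ_e` lies over `S`. [cite: MilneAV2008, I §8 pp. 36–37] -/
@[reassoc (attr := simp)]
theorem hatTransport_comp_hom : hatTransport D D' e ≫ D.hat.X.hom = D'.hat.X.hom :=
  D.classify_comp_hom _ _ _

/-- `(1_A × Ĥ_e)^*𝒫 ≅ (e⁻¹ × 1)^*𝒫'`. [cite: MilneAV2008, I §8 pp. 36–37] -/
theorem nonempty_pullbackP_hatTransport_iso :
    Nonempty (D.pullbackP D'.hat.X.hom (hatTransport D D' e) (hatTransport_comp_hom D D' e) ≅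
      (Scheme.Modules.pullback (transportMap D' e)).obj D'.P) :=
  D.nonempty_pullbackP_classify_iso _ _ _

/-- `e × 1_{Â'} : A' ×_S Â' → A ×_S Â'`, the inverse of `e⁻¹ × 1` (non-Prop plumbing). [cite: MilneAV2008, I §8 pp. 36–37] -/
def transportMapInv : A'.prodLeft D'.hat ⟶ (A.baseChange D'.hat.X.hom).left :=
  pullback.map A'.X.hom D'.hat.X.hom A.X.hom D'.hat.X.hom e.hom.left (𝟙 _) (𝟙 S)
    (by rw [Category.comp_id, Over.w e.hom]) (by rw [Category.comp_id, Category.id_comp])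

omit [IsMonHom e.hom] in
/-- First projection of `e × 1`. [cite: MilneAV2008, I §8 pp. 36–37] -/
@[reassoc (attr := simp)]
theorem transportMapInv_fst : transportMapInv D' e ≫ pullback.fst A.X.hom D'.hat.X.hom =
    pullback.fst A'.X.hom D'.hat.X.hom ≫ e.hom.left :=
  pullback.lift_fst _ _ _

omit [IsMonHom e.hom] in
/-- Second projection of `e × 1`. [cite: MilneAV2008, I §8 pp. 36–37] -/
@[reassoc (attr := simp)]
theorem transportMapInv_snd : transportMapInv D' e ≫ pullback.snd A.X.hom D'.hat.X.hom =
    pullback.snd A'.X.hom D'.hat.X.hom :=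
  (pullback.lift_snd _ _ _).trans (Category.comp_id _)

omit [IsMonHom e.hom] in
/-- `(e × 1) ≫ (e⁻¹ × 1) = 𝟙`. [cite: MilneAV2008, I §8 pp. 36–37] -/
@[reassoc (attr := simp)]
theorem transportMapInv_comp_transportMap : transportMapInv D' e ≫ transportMap D' e = 𝟙 _ := by
  have hee : e.hom.left ≫ e.inv.left = 𝟙 _ := by rw [← Over.comp_left, Iso.hom_inv_id, Over.id_left]
  apply pullback.hom_ext
  · exact (Category.assoc _ _ _).trans
      ((congrArg (fun x => transportMapInv D' e ≫ x) (transportMap_fst D' e)).trans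
        ((Category.assoc _ _ _).symm.trans
          ((congrArg (fun x => x ≫ e.inv.left) (transportMapInv_fst D' e)).trans
            ((Category.assoc _ _ _).trans
              ((congrArg (fun x => pullback.fst A'.X.hom D'.hat.X.hom ≫ x) hee).trans
                ((Category.comp_id _).trans (Category.id_comp _).symm))))))
  · exact (Category.assoc _ _ _).trans
      ((congrArg (fun x => transportMapInv D' e ≫ x) (transportMap_snd D' e)).trans
        ((transportMapInv_snd D' e).trans (Category.id_comp _).symm))

/-- `(e × 1) ≫ (1 × Ĥ_e) = e × Ĥ_e`, the map of [MFK94] Def. 7.3's Poincaré clause along `𝟙 S`. [cite: MumfordFogartyKirwan1994, Ch. 7 §2 Definition 7.3 (p. 130)] -/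
theorem transportMapInv_comp_baseChangeToProd :
    transportMapInv D' e ≫ A.baseChangeToProd D.hat D'.hat.X.hom (hatTransport D D' e) (hatTransport_comp_hom D D' e) =
      pullback.map A'.X.hom D'.hat.X.hom A.X.hom D.hat.X.hom e.hom.left (hatTransport D D' e) (𝟙 S)
        (by rw [Category.comp_id, Over.w e.hom]) (by rw [Category.comp_id, hatTransport_comp_hom]) := by
  apply pullback.hom_ext
  · exact (Category.assoc _ _ _).trans
      ((congrArg (fun x => transportMapInv D' e ≫ x) (A.baseChangeToProd_fst D.hat D'.hat.X.hom _ _)).trans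
        ((transportMapInv_fst D' e).trans (pullback.lift_fst _ _ _).symm))
  · exact (Category.assoc _ _ _).trans
      ((congrArg (fun x => transportMapInv D' e ≫ x) (A.baseChangeToProd_snd D.hat D'.hat.X.hom _ _)).trans
        ((Category.assoc _ _ _).symm.trans
          ((congrArg (fun x => x ≫ hatTransport D D' e) (transportMapInv_snd D' e)).trans
            (pullback.lift_snd _ _ _).symm)))

/-- **The Poincaré clause of [MFK94] Def. 7.3 along `𝟙 S` for `(e, Ĥ_e)`**: `(e × Ĥ_e)^*𝒫 ≅ 𝒫'`.
[cite: MumfordFogartyKirwan1994, Ch. 7 §2 Definition 7.3 (p. 130)] [cite: MilneAV2008, I §8 pp. 36–37] -/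
theorem nonempty_pullback_map_hatTransport_iso :
    Nonempty ((Scheme.Modules.pullback
      (pullback.map A'.X.hom D'.hat.X.hom A.X.hom D.hat.X.hom e.hom.left (hatTransport D D' e) (𝟙 S)
        (by rw [Category.comp_id, Over.w e.hom]) (by rw [Category.comp_id, hatTransport_comp_hom]))).obj D.P ≅ D'.P) := by
  obtain ⟨i⟩ := nonempty_pullbackP_hatTransport_iso D D' e
  refine ⟨(Scheme.Modules.pullbackCongr (transportMapInv_comp_baseChangeToProd D D' e).symm).app D.P ≪≫
    ((Scheme.Modules.pullbackComp _ _).app D.P).symm ≪≫ (Scheme.Modules.pullback (transportMapInv D' e)).mapIso i ≪≫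
    (Scheme.Modules.pullbackComp _ _).app D'.P ≪≫
    (Scheme.Modules.pullbackCongr (transportMapInv_comp_transportMap D' e)).app D'.P ≪≫
    (Scheme.Modules.pullbackId _).app D'.P⟩

/-! ### §3 `Ĥ_e` is an isomorphism (two-sided uniqueness) -/

/-- The unit section of `A_{Â} = A ×_S Â` IS the unit slice `ε_A × 1_Â` (both are `(π̂ ≫ ε_A, 𝟙)`).
[cite: MilneAV2008, I §8 pp. 36–37] -/
theorem unitSection_baseChange_hat_eq_unitSlice : (A.baseChange D.hat.X.hom).unitSection = A.unitSlice D.hat := by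
  have hsec : (A.baseChange D.hat.X.hom).unitSection ≫ pullback.snd A.X.hom D.hat.X.hom = 𝟙 _ :=
    (A.baseChange D.hat.X.hom).unitSection_comp_hom
  apply pullback.hom_ext
  · exact (unitSection_baseChange_comp_fst A D.hat.X.hom).trans (A.unitSlice_fst D.hat).symm
  · exact hsec.trans (A.unitSlice_snd D.hat).symm

/-- **`𝒫` itself as a rigidified family on `A_{Â}`** (the family classified by `1_Â`; non-Prop plumbing).
[cite: MilneAV2008, I §8 pp. 36–37] -/
def selfBundle : A.RigidifiedLineBundle D.hat.X.hom where
  L := D.P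
  hasRank_one := D.hasRank_one
  rigid := ⟨(Scheme.Modules.pullbackCongr (unitSection_baseChange_hat_eq_unitSlice D)).app D.P ≪≫ D.rigid.some⟩

/-- The module of `selfBundle` is `𝒫`. [cite: MilneAV2008, I §8 pp. 36–37] -/
@[simp] theorem selfBundle_L : (selfBundle D).L = D.P := rfl

set_option maxHeartbeats 400000 in
/-- `𝒫` lies fibrewise in `Pic⁰` over `Â` (clause (a) of the dual pair, transported along `(A_{Â})_t ≅ A_{t ≫ π̂}`).
[cite: MumfordAV1970, §8 ((iv) ⇔ (i))] [cite: MilneAV2008, I §8 pp. 36–37] -/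
theorem selfBundle_fibrewisePicZero : (selfBundle D).FibrewisePicZero := by
  intro Ω _ _ t
  have key := D.fibrewisePicZero Ω t
  have hcond : pullback.fst (A.baseChange D.hat.X.hom).X.hom t ≫ pullback.snd A.X.hom D.hat.X.hom =
      pullback.snd (A.baseChange D.hat.X.hom).X.hom t ≫ t := pullback.condition
  have hc : AbelianVariety.Hom.toSchemeHom (A.fibreBaseChangeIso D.hat.X.hom t).hom ≫ A.fibreSlice D.hat t =
      pullback.fst (A.baseChange D.hat.X.hom).X.hom t := by
    apply pullback.hom_ext
    · exact (Category.assoc _ _ _).trans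
        ((congrArg (fun x => AbelianVariety.Hom.toSchemeHom (A.fibreBaseChangeIso D.hat.X.hom t).hom ≫ x)
            (A.fibreSlice_fst D.hat t)).trans
          (A.fibreBaseChangeIso_hom_toSchemeHom_fst D.hat.X.hom t))
    · exact (Category.assoc _ _ _).trans
        ((congrArg (fun x => AbelianVariety.Hom.toSchemeHom (A.fibreBaseChangeIso D.hat.X.hom t).hom ≫ x)
            (A.fibreSlice_snd D.hat t)).trans
          ((Category.assoc _ _ _).symm.trans
            ((congrArg (fun x => x ≫ t) (A.fibreBaseChangeIso_hom_toSchemeHom_snd D.hat.X.hom t)).trans hcond.symm)))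
  have k1 := (isHomogeneous_pullback_iff_of_iso (A.fibreBaseChangeIso D.hat.X.hom t) _).2 key
  exact (isHomogeneous_iff_of_iso _ ((Scheme.Modules.pullbackComp _ _).app D.P ≪≫
    (Scheme.Modules.pullbackCongr hc).app D.P)).1 k1

/-- `1_A × 1_Â = 𝟙`. [cite: MilneAV2008, I §8 pp. 36–37] -/
theorem baseChangeToProd_id : A.baseChangeToProd D.hat D.hat.X.hom (𝟙 _) (Category.id_comp _) = 𝟙 _ := by
  apply pullback.hom_ext
  · exact (A.baseChangeToProd_fst D.hat _ _ _).trans (Category.id_comp _).symm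
  · exact (A.baseChangeToProd_snd D.hat _ _ _).trans ((Category.comp_id _).trans (Category.id_comp _).symm)

/-- `(1_A × 1_Â)^*𝒫 ≅ 𝒫`. [cite: MilneAV2008, I §8 pp. 36–37] -/
theorem nonempty_pullbackP_id_iso :
    Nonempty (D.pullbackP D.hat.X.hom (𝟙 _) (Category.id_comp _) ≅ (selfBundle D).L) :=
  ⟨(Scheme.Modules.pullbackCongr (baseChangeToProd_id D)).app D.P ≪≫ (Scheme.Modules.pullbackId _).app D.P⟩

/-- `1_A × (h₁ ≫ h₂) = (1_A × h₁) ≫ (1_A × h₂)`. [cite: MilneAV2008, I §8 pp. 36–37] -/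
theorem baseChangeToProd_comp {T : Scheme.{u}} {B B' : AbelianSchemeOver S} (f : T ⟶ S) (h₁ : T ⟶ B'.X.left)
    (h₂ : B'.X.left ⟶ B.X.left) (hh₁ : h₁ ≫ B'.X.hom = f) (hh₂ : h₂ ≫ B.X.hom = B'.X.hom) :
    A.baseChangeToProd B f (h₁ ≫ h₂) (by rw [Category.assoc, hh₂, hh₁]) =
      A.baseChangeToProd B' f h₁ hh₁ ≫ A.baseChangeToProd B B'.X.hom h₂ hh₂ := by
  apply pullback.hom_ext
  · exact (A.baseChangeToProd_fst B f _ _).trans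
      ((A.baseChangeToProd_fst B' f h₁ hh₁).symm.trans
        ((congrArg (fun x => A.baseChangeToProd B' f h₁ hh₁ ≫ x) (A.baseChangeToProd_fst B B'.X.hom h₂ hh₂)).symm.trans
          (Category.assoc _ _ _).symm))
  · exact (A.baseChangeToProd_snd B f _ _).trans
      ((Category.assoc _ _ _).symm.trans
        ((congrArg (fun x => x ≫ h₂) (A.baseChangeToProd_snd B' f h₁ hh₁).symm).trans
          ((Category.assoc _ _ _).trans
            ((congrArg (fun x => A.baseChangeToProd B' f h₁ hh₁ ≫ x) (A.baseChangeToProd_snd B B'.X.hom h₂ hh₂)).symm.trans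
              (Category.assoc _ _ _).symm))))

variable (e' : A.X ≅ A'.X) [IsMonHom e'.hom]

omit [IsMonHom e.hom] [IsMonHom e'.hom] in
/-- `(1_A × h₁) ≫ (e⁻¹ × 1_{Â'}) = (e' × 1_Â) ≫ (1_{A'} × h₁)` when `e' = e⁻¹`. [cite: MilneAV2008, I §8 pp. 36–37] -/
theorem baseChangeToProd_comp_transportMap (he' : e'.hom = e.inv) (h₁ : D.hat.X.left ⟶ D'.hat.X.left)
    (hh₁ : h₁ ≫ D'.hat.X.hom = D.hat.X.hom) :
    A.baseChangeToProd D'.hat D.hat.X.hom h₁ hh₁ ≫ transportMap D' e =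
      transportMapInv D e' ≫ A'.baseChangeToProd D'.hat D.hat.X.hom h₁ hh₁ := by
  apply pullback.hom_ext
  · exact (Category.assoc _ _ _).trans
      ((congrArg (fun x => A.baseChangeToProd D'.hat D.hat.X.hom h₁ hh₁ ≫ x) (transportMap_fst D' e)).trans
        ((Category.assoc _ _ _).symm.trans
          ((congrArg (fun x => x ≫ e.inv.left) (A.baseChangeToProd_fst D'.hat D.hat.X.hom h₁ hh₁)).trans
            ((congrArg (fun x => pullback.fst A.X.hom D.hat.X.hom ≫ Over.Hom.left x) he').symm.trans
              ((transportMapInv_fst D e').symm.trans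
                ((congrArg (fun x => transportMapInv D e' ≫ x) (A'.baseChangeToProd_fst D'.hat D.hat.X.hom h₁ hh₁)).symm.trans
                  (Category.assoc _ _ _).symm))))))
  · exact (Category.assoc _ _ _).trans
      ((congrArg (fun x => A.baseChangeToProd D'.hat D.hat.X.hom h₁ hh₁ ≫ x) (transportMap_snd D' e)).trans
        ((A.baseChangeToProd_snd D'.hat D.hat.X.hom h₁ hh₁).trans
          ((congrArg (fun x => x ≫ h₁) (transportMapInv_snd D e')).symm.trans
            ((Category.assoc _ _ _).trans
              ((congrArg (fun x => transportMapInv D e' ≫ x) (A'.baseChangeToProd_snd D'.hat D.hat.X.hom h₁ hh₁)).symm.trans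
                (Category.assoc _ _ _).symm)))))

/-- **`Ĥ_{e'} ≫ Ĥ_e = 𝟙` for `e' = e⁻¹`** — uniqueness in the universal property: `(1 × (Ĥ_{e'} ≫ Ĥ_e))^*𝒫 ≅
(e' × 1)^*(e × 1)^*𝒫 ≅ 𝒫 = (1 × 1_Â)^*𝒫`, so both classify `𝒫` itself ([MilneAV2008, I §8] «unique»).
[cite: MilneAV2008, I §8 pp. 36–37] -/
theorem hatTransport_comp_hatTransport (he' : e'.hom = e.inv) :
    hatTransport D' D e' ≫ hatTransport D D' e = 𝟙 D.hat.X.left := by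
  have hg : (hatTransport D' D e' ≫ hatTransport D D' e) ≫ D.hat.X.hom = D.hat.X.hom := by
    rw [Category.assoc, hatTransport_comp_hom, hatTransport_comp_hom]
  obtain ⟨i₁⟩ := nonempty_pullbackP_hatTransport_iso D' D e'
  obtain ⟨i₂⟩ := nonempty_pullbackP_hatTransport_iso D D' e
  refine D.eq_of_nonempty_iso D.hat.X.hom (selfBundle D) (selfBundle_fibrewisePicZero D) _ _ hg (Category.id_comp _)
    ⟨?_⟩ (nonempty_pullbackP_id_iso D)
  exact (Scheme.Modules.pullbackCongr (baseChangeToProd_comp (A := A) (B := D.hat) (B' := D'.hat) D.hat.X.hom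
      (hatTransport D' D e') (hatTransport D D' e) (hatTransport_comp_hom D' D e') (hatTransport_comp_hom D D' e))).app D.P ≪≫
    ((Scheme.Modules.pullbackComp _ _).app D.P).symm ≪≫
    (Scheme.Modules.pullback _).mapIso i₂ ≪≫
    (Scheme.Modules.pullbackComp _ _).app D'.P ≪≫
    (Scheme.Modules.pullbackCongr (baseChangeToProd_comp_transportMap D D' e e' he' (hatTransport D' D e')
      (hatTransport_comp_hom D' D e'))).app D'.P ≪≫
    ((Scheme.Modules.pullbackComp _ _).app D'.P).symm ≪≫
    (Scheme.Modules.pullback _).mapIso i₁ ≪≫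
    (Scheme.Modules.pullbackComp _ _).app D.P ≪≫
    (Scheme.Modules.pullbackCongr (transportMapInv_comp_transportMap D e')).app D.P ≪≫
    (Scheme.Modules.pullbackId _).app D.P

omit [IsMonHom e.hom] [IsMonHom e'.hom] in
/-- From `e' = e⁻¹` (as a morphism) to `e = e'⁻¹` (inverse of an isomorphism of `S`-schemes). [cite: GortzWedhorn2020, Section (4.7) (p. 135)] -/
theorem hom_eq_inv_of_hom_eq_inv (he' : e'.hom = e.inv) : e.hom = e'.inv := by
  have h : e' = e.symm := Iso.ext he'
  subst h
  rfl

/-- **The dual transport is an isomorphism `Ĥ_e : Â' ≅ Â`** with inverse `Ĥ_{e⁻¹}` (both composites are the identity by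
uniqueness). [cite: MilneAV2008, I §8 pp. 36–37] [cite: MumfordFogartyKirwan1994, Ch. 7 §2 Definition 7.3 (p. 130)] -/
def hatTransportIso (he' : e'.hom = e.inv) : D'.hat.X.left ≅ D.hat.X.left where
  hom := hatTransport D D' e
  inv := hatTransport D' D e'
  hom_inv_id := hatTransport_comp_hatTransport D' D e' e (hom_eq_inv_of_hom_eq_inv e e' he')
  inv_hom_id := hatTransport_comp_hatTransport D D' e e' he'

/-- The underlying morphism of `hatTransportIso` is `Ĥ_e`. [cite: MilneAV2008, I §8 pp. 36–37] -/
@[simp] theorem hatTransportIso_hom (he' : e'.hom = e.inv) : (hatTransportIso D D' e e' he').hom = hatTransport D D' e := rfl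

/-- The inverse of `hatTransportIso` is `Ĥ_{e⁻¹}`. [cite: MilneAV2008, I §8 pp. 36–37] -/
@[simp] theorem hatTransportIso_inv (he' : e'.hom = e.inv) : (hatTransportIso D D' e e' he').inv = hatTransport D' D e' := rfl

/-- `Ĥ_e` is an isomorphism. [cite: MilneAV2008, I §8 pp. 36–37] -/
theorem isIso_hatTransport (he' : e'.hom = e.inv) : IsIso (hatTransport D D' e) :=
  (hatTransportIso D D' e e' he').isIso_hom

/-! ### §4 `Ĥ_e` preserves the unit section; over a field it is a homomorphism — clause (ii) of [MFK94] Def. 7.3 along `𝟙` -/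

/-- The slice `A × {ε_Â} : A → A ×_S Â`, `a ↦ (a, ε_Â(π a))` (non-Prop plumbing). [cite: MilneAV2008, I §8 pp. 36–37] -/
def unitHatSlice : A.X.left ⟶ A.prodLeft D.hat :=
  pullback.lift (𝟙 _) (A.X.hom ≫ D.hat.unitSection)
    (by rw [Category.id_comp, Category.assoc, AbelianSchemeOver.unitSection_comp_hom, Category.comp_id])

omit [IsMonHom e.hom] in
/-- First projection of `A × {ε_Â}`. [cite: MilneAV2008, I §8 pp. 36–37] -/
@[reassoc (attr := simp)]
theorem unitHatSlice_fst : unitHatSlice D ≫ pullback.fst A.X.hom D.hat.X.hom = 𝟙 _ :=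
  pullback.lift_fst _ _ _

omit [IsMonHom e.hom] in
/-- Second projection of `A × {ε_Â}`. [cite: MilneAV2008, I §8 pp. 36–37] -/
@[reassoc (attr := simp)]
theorem unitHatSlice_snd : unitHatSlice D ≫ pullback.snd A.X.hom D.hat.X.hom = A.X.hom ≫ D.hat.unitSection :=
  pullback.lift_snd _ _ _

/-- **The trivial rigidified family `𝒪` on `A_S = A ×_S S`** (non-Prop plumbing; the family both unit sections classify).
[cite: MilneAV2008, I §8 pp. 36–37] -/
def trivialBundle (A : AbelianSchemeOver S) : A.RigidifiedLineBundle (𝟙 S) where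
  L := SheafOfModules.unit _
  hasRank_one := hasRank_unit_one
  rigid := by
    have hI : IsIso (SheafOfModules.pullbackObjUnitToUnit (A.baseChange (𝟙 S)).unitSection.toRingCatSheafHom) := by
      haveI := Literature.AlgebraicGeometry.KTheory.final_opensMap (A.baseChange (𝟙 S)).unitSection
      exact SheafOfModules.instIsIsoPullbackObjUnitToUnitOfFinal _
    exact ⟨@asIso _ _ _ _ (SheafOfModules.pullbackObjUnitToUnit (A.baseChange (𝟙 S)).unitSection.toRingCatSheafHom) hI⟩

/-- The module of the trivial family is `𝒪`. [cite: MilneAV2008, I §8 pp. 36–37] -/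
@[simp] theorem trivialBundle_L (A : AbelianSchemeOver S) : (trivialBundle A).L = SheafOfModules.unit _ := rfl

/-- The trivial family lies fibrewise in `Pic⁰` (`𝒪` is translation invariant, ★ `isHomogeneous_unit`).
[cite: MumfordAV1970, §8 ((iv) ⇔ (i))] -/
theorem trivialBundle_fibrewisePicZero (A : AbelianSchemeOver S) : (trivialBundle A).FibrewisePicZero := by
  intro Ω _ _ t
  have hI : IsIso (SheafOfModules.pullbackObjUnitToUnit (pullback.fst (A.baseChange (𝟙 S)).X.hom t).toRingCatSheafHom) := by
    haveI := Literature.AlgebraicGeometry.KTheory.final_opensMap (pullback.fst (A.baseChange (𝟙 S)).X.hom t)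
    exact SheafOfModules.instIsIsoPullbackObjUnitToUnitOfFinal _
  exact (isHomogeneous_iff_of_iso _
    (@asIso _ _ _ _ (SheafOfModules.pullbackObjUnitToUnit (pullback.fst (A.baseChange (𝟙 S)).X.hom t).toRingCatSheafHom)
      hI)).2 (isHomogeneous_unit _)

omit [IsMonHom e.hom] in
/-- `1_A × ε_Â = (A_S → A) ≫ (A × {ε_Â})`. [cite: MilneAV2008, I §8 pp. 36–37] -/
theorem baseChangeToProd_unitSection :
    A.baseChangeToProd D.hat (𝟙 S) D.hat.unitSection D.hat.unitSection_comp_hom =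
      pullback.fst A.X.hom (𝟙 S) ≫ unitHatSlice D := by
  have hcond : pullback.fst A.X.hom (𝟙 S) ≫ A.X.hom = pullback.snd A.X.hom (𝟙 S) ≫ 𝟙 S := pullback.condition
  apply pullback.hom_ext
  · exact (A.baseChangeToProd_fst D.hat _ _ _).trans
      ((Category.comp_id _).symm.trans
        ((congrArg (fun x => pullback.fst A.X.hom (𝟙 S) ≫ x) (unitHatSlice_fst D)).symm.trans
          (Category.assoc _ _ _).symm))
  · exact (A.baseChangeToProd_snd D.hat _ _ _).trans
      ((congrArg (fun x => x ≫ D.hat.unitSection) ((Category.comp_id _).symm.trans hcond.symm)).trans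
        ((Category.assoc _ _ _).trans
          ((congrArg (fun x => pullback.fst A.X.hom (𝟙 S) ≫ x) (unitHatSlice_snd D)).symm.trans
            (Category.assoc _ _ _).symm)))

/-- `(1_A × ε_Â)^*𝒫 ≅ 𝒪` when `𝒫|_{A × {ε_Â}}` is trivial. [cite: MilneAV2008, I §8 pp. 36–37] -/
theorem nonempty_pullbackP_unitSection_iso (hD : Nonempty ((Scheme.Modules.pullback (unitHatSlice D)).obj D.P ≅ SheafOfModules.unit _)) :
    Nonempty (D.pullbackP (𝟙 S) D.hat.unitSection D.hat.unitSection_comp_hom ≅ (trivialBundle A).L) := by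
  obtain ⟨i⟩ := hD
  have hI : IsIso (SheafOfModules.pullbackObjUnitToUnit (pullback.fst A.X.hom (𝟙 S)).toRingCatSheafHom) := by
    haveI := Literature.AlgebraicGeometry.KTheory.final_opensMap (pullback.fst A.X.hom (𝟙 S))
    exact SheafOfModules.instIsIsoPullbackObjUnitToUnitOfFinal _
  exact ⟨(Scheme.Modules.pullbackCongr (baseChangeToProd_unitSection D)).app D.P ≪≫
    ((Scheme.Modules.pullbackComp _ _).app D.P).symm ≪≫ (Scheme.Modules.pullback _).mapIso i ≪≫
    @asIso _ _ _ _ (SheafOfModules.pullbackObjUnitToUnit (pullback.fst A.X.hom (𝟙 S)).toRingCatSheafHom) hI⟩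

omit [IsMonHom e.hom] in
/-- `(1_A × ε_{Â'}) ≫ (e⁻¹ × 1) = (A_S → A → A') ≫ (A' × {ε_{Â'}})`. [cite: MilneAV2008, I §8 pp. 36–37] -/
theorem baseChangeToProd_unitSection_comp_transportMap :
    A.baseChangeToProd D'.hat (𝟙 S) D'.hat.unitSection D'.hat.unitSection_comp_hom ≫ transportMap D' e =
      (pullback.fst A.X.hom (𝟙 S) ≫ e.inv.left) ≫ unitHatSlice D' := by
  have hcond : pullback.fst A.X.hom (𝟙 S) ≫ A.X.hom = pullback.snd A.X.hom (𝟙 S) ≫ 𝟙 S := pullback.condition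
  apply pullback.hom_ext
  · exact (Category.assoc _ _ _).trans
      ((congrArg (fun x => A.baseChangeToProd D'.hat (𝟙 S) D'.hat.unitSection D'.hat.unitSection_comp_hom ≫ x)
          (transportMap_fst D' e)).trans
        ((Category.assoc _ _ _).symm.trans
          ((congrArg (fun x => x ≫ e.inv.left) (A.baseChangeToProd_fst D'.hat _ _ _)).trans
            ((Category.comp_id _).symm.trans
              ((congrArg (fun x => (pullback.fst A.X.hom (𝟙 S) ≫ e.inv.left) ≫ x) (unitHatSlice_fst D')).symm.trans
                (Category.assoc _ _ _).symm)))))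
  · exact (Category.assoc _ _ _).trans
      ((congrArg (fun x => A.baseChangeToProd D'.hat (𝟙 S) D'.hat.unitSection D'.hat.unitSection_comp_hom ≫ x)
          (transportMap_snd D' e)).trans
        ((A.baseChangeToProd_snd D'.hat _ _ _).trans
          ((congrArg (fun x => x ≫ D'.hat.unitSection) ((Category.comp_id _).symm.trans hcond.symm)).trans
            ((congrArg (fun x => (pullback.fst A.X.hom (𝟙 S) ≫ x) ≫ D'.hat.unitSection) (Over.w e.inv).symm).trans
              ((congrArg (fun x => x ≫ D'.hat.unitSection) (Category.assoc _ _ _).symm).trans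
                ((Category.assoc _ _ _).trans
                  ((congrArg (fun x => (pullback.fst A.X.hom (𝟙 S) ≫ e.inv.left) ≫ x) (unitHatSlice_snd D')).symm.trans
                    (Category.assoc _ _ _).symm)))))))

/-- `(1_A × (ε_{Â'} ≫ Ĥ_e))^*𝒫 ≅ 𝒪` when `𝒫'|_{A' × {ε_{Â'}}}` is trivial. [cite: MilneAV2008, I §8 pp. 36–37] -/
theorem nonempty_pullbackP_unitSection_comp_hatTransport_iso (hD' : Nonempty ((Scheme.Modules.pullback (unitHatSlice D')).obj D'.P ≅ SheafOfModules.unit _)) :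
    Nonempty (D.pullbackP (𝟙 S) (D'.hat.unitSection ≫ hatTransport D D' e)
      (by rw [Category.assoc, hatTransport_comp_hom, D'.hat.unitSection_comp_hom]) ≅ (trivialBundle A).L) := by
  obtain ⟨i'⟩ := hD'
  obtain ⟨i₂⟩ := nonempty_pullbackP_hatTransport_iso D D' e
  have hI : IsIso (SheafOfModules.pullbackObjUnitToUnit (pullback.fst A.X.hom (𝟙 S) ≫ e.inv.left).toRingCatSheafHom) := by
    haveI := Literature.AlgebraicGeometry.KTheory.final_opensMap (pullback.fst A.X.hom (𝟙 S) ≫ e.inv.left)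
    exact SheafOfModules.instIsIsoPullbackObjUnitToUnitOfFinal _
  exact ⟨(Scheme.Modules.pullbackCongr (baseChangeToProd_comp (A := A) (B := D.hat) (B' := D'.hat) (𝟙 S)
      D'.hat.unitSection (hatTransport D D' e) D'.hat.unitSection_comp_hom (hatTransport_comp_hom D D' e))).app D.P ≪≫
    ((Scheme.Modules.pullbackComp _ _).app D.P).symm ≪≫
    (Scheme.Modules.pullback _).mapIso i₂ ≪≫
    (Scheme.Modules.pullbackComp _ _).app D'.P ≪≫
    (Scheme.Modules.pullbackCongr (baseChangeToProd_unitSection_comp_transportMap D' e)).app D'.P ≪≫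
    ((Scheme.Modules.pullbackComp _ _).app D'.P).symm ≪≫
    (Scheme.Modules.pullback _).mapIso i' ≪≫
    @asIso _ _ _ _ (SheafOfModules.pullbackObjUnitToUnit (pullback.fst A.X.hom (𝟙 S) ≫ e.inv.left).toRingCatSheafHom) hI⟩

/-- **`Ĥ_e` PRESERVES THE UNIT SECTIONS: `ε_{Â'} ≫ Ĥ_e = ε_Â`** — both classify the trivial family `𝒪` on `A`
(uniqueness in [MilneAV2008, I §8]), granted that `𝒫|_{A × {ε_Â}}` and `𝒫'|_{A' × {ε_{Â'}}}` are trivial (hypotheses `hD`, `hD'`: NOT a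
field of ★ D2 `DualPair`, which normalises along `ε_A × 1_Â` only; automatic for POLARISED abelian schemes, where `λ(1) = ε_Â`
and `IsLambdaOfAt` at the origin reads `𝒫|_{A × {λ(1)}} ≅ t_1^*𝒪(Θ) ⊗ 𝒪(Θ)⁻¹ ≅ 𝒪`). [cite: MilneAV2008, I §8 pp. 36–37] [cite: MumfordFogartyKirwan1994, Ch. 7 §2 Definition 7.3 (p. 130)] -/
theorem unitSection_comp_hatTransport (hD : Nonempty ((Scheme.Modules.pullback (unitHatSlice D)).obj D.P ≅ SheafOfModules.unit _)) (hD' : Nonempty ((Scheme.Modules.pullback (unitHatSlice D')).obj D'.P ≅ SheafOfModules.unit _)) :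
    D'.hat.unitSection ≫ hatTransport D D' e = D.hat.unitSection :=
  D.eq_of_nonempty_iso (𝟙 S) (trivialBundle A) (trivialBundle_fibrewisePicZero A) _ _
    (by rw [Category.assoc, hatTransport_comp_hom, D'.hat.unitSection_comp_hom]) D.hat.unitSection_comp_hom
    (nonempty_pullbackP_unitSection_comp_hatTransport_iso D D' e hD') (nonempty_pullbackP_unitSection_iso D hD)

/-- `Ĥ_e` as a morphism over `S` (non-Prop plumbing). [cite: MumfordFogartyKirwan1994, Ch. 7 §2 Definition 7.3 (p. 130)] -/
def hatTransportOver : D'.hat.X ⟶ D.hat.X :=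
  Over.homMk (hatTransport D D' e) (hatTransport_comp_hom D D' e)

/-- The underlying scheme morphism of `hatTransportOver` is `Ĥ_e`. [cite: MumfordFogartyKirwan1994, Ch. 7 §2 Definition 7.3 (p. 130)] -/
@[simp] theorem hatTransportOver_left : (hatTransportOver D D' e).left = hatTransport D D' e := rfl

/-- `η_{Â'} ≫ Ĥ_e = η_Â` in `Over S`. [cite: MumfordFogartyKirwan1994, Ch. 7 §2 Definition 7.3 (p. 130)] -/
theorem one_comp_hatTransportOver (hD : Nonempty ((Scheme.Modules.pullback (unitHatSlice D)).obj D.P ≅ SheafOfModules.unit _)) (hD' : Nonempty ((Scheme.Modules.pullback (unitHatSlice D')).obj D'.P ≅ SheafOfModules.unit _)) :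
    η[D'.hat.X] ≫ hatTransportOver D D' e = η[D.hat.X] :=
  Over.OverMorphism.ext (by
    rw [Over.comp_left, hatTransportOver_left]
    exact unitSection_comp_hatTransport D D' e hD hD')

/-- `hatTransportOver` is an isomorphism (from `hatTransportIso`). [cite: MilneAV2008, I §8 pp. 36–37] -/
theorem isIso_hatTransportOver (he' : e'.hom = e.inv) : IsIso (hatTransportOver D D' e) := by
  have h : hatTransportOver D D' e =
      (Over.isoMk (hatTransportIso D D' e e' he') (hatTransport_comp_hom D D' e)).hom :=
    Over.OverMorphism.ext rfl
  rw [h]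
  infer_instance

end DualPair

/-! #### Over a field `K`: rigidity makes `Ĥ_e` a homomorphism -/

namespace DualPair

variable {K : Type u} [Field K] {A A' : AbelianSchemeOver (Spec (.of K))} (D : A.DualPair) (D' : A'.DualPair)
  (e : A'.X ≅ A.X) [IsMonHom e.hom]

/-- **`Ĥ_e` IS A HOMOMORPHISM of `Spec K`-group schemes** — rigidity ([MilneAV2008] I Cor. 1.2 = ★
`Motives.isMonHom_of_one_comp`, a morphism of abelian varieties preserving the origin is a homomorphism) applied to the
total spaces `Â'`, `Â` (abelian varieties over `K`) and `ε_{Â'} ≫ Ĥ_e = ε_Â`. [cite: MilneAV2008, I Cor. 1.2 (p. 8) and §8 pp. 36–37]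
[cite: MumfordFogartyKirwan1994, Ch. 6 §1 Corollary 6.4 (p. 117)] -/
theorem isMonHom_hatTransportOver (hD : Nonempty ((Scheme.Modules.pullback (unitHatSlice D)).obj D.P ≅ SheafOfModules.unit _)) (hD' : Nonempty ((Scheme.Modules.pullback (unitHatSlice D')).obj D'.P ≅ SheafOfModules.unit _)) :
    IsMonHom (hatTransportOver D D' e) :=
  Motives.isMonHom_of_one_comp (A := D'.hat.toAffine.toAbelianVariety) (B := D.hat.toAffine.toAbelianVariety)
    (hatTransportOver D D' e) (one_comp_hatTransportOver D D' e hD hD')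

/-- **CLAUSE (ii) OF [MFK94] Def. 7.3 ALONG `𝟙 (Spec K)` FOR `(e, Ĥ_e)`**: `Â'` is the base change of `Â` along `𝟙` via
`Ĥ_e` AS GROUP SCHEMES (`AbelianSchemeOver.IsBaseChangeVia`: cartesian square + unit + multiplication), from
`isMonHom_hatTransportOver` + `isIso` + ★ `isBaseChangeVia_id_of_isMonHom`. [cite: MumfordFogartyKirwan1994, Ch. 7 §2 Definition 7.3 (p. 130)] -/
theorem hat_isBaseChangeVia_id_hatTransport (e' : A.X ≅ A'.X) [IsMonHom e'.hom] (he' : e'.hom = e.inv)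
    (hD : Nonempty ((Scheme.Modules.pullback (unitHatSlice D)).obj D.P ≅ SheafOfModules.unit _)) (hD' : Nonempty ((Scheme.Modules.pullback (unitHatSlice D')).obj D'.P ≅ SheafOfModules.unit _)) :
    D'.hat.IsBaseChangeVia D.hat (𝟙 (Spec (.of K))) (hatTransport D D' e) := by
  haveI := isIso_hatTransportOver D D' e e' he'
  haveI := isMonHom_hatTransportOver D D' e hD hD'
  exact isBaseChangeVia_id_of_isMonHom D'.hat D.hat (hatTransportOver D D' e)

end DualPair

end AbelianSchemeOver

end Literature.AlgebraicGeometry.AbelianSchemes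

end
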